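import Mathlib
import Literature.NumberTheory.LFunctions.Zhang2022.Section4TildeZ
import Literature.NumberTheory.LFunctions.Zhang2022.Section8Reflection
import HarnessLib

/-!
# Zhang (2022), §4 p. 9 (proof of Lemma 4.5, Case 2): "Since `|ℬ(1/2+it,ψ)| = 1`" — EXACT,
# kernel-checked

Topic `Literature/NumberTheory/LFunctions/Zhang2022` (Landau–Siegel autopsy tree; verdict-neutral).
Y. Zhang, *Discrete mean estimates and the Landau–Siegel zero*, arXiv:2211.02515v1 (2022) — **an
unrefereed manuscript, a claimed result under adjudication** (cell pub-zhang: audit + repair census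
of arXiv:2211.02515; no claim about Landau–Siegel) — §4 p. 9:

> […] where `ℬ(s,ψ) = Z̃(s,ψ)F(1−s,ψ̄)/F(s,ψ)`. […] Since `|ℬ(1/2+it,ψ)| = 1`, it follows that
> `log|ℬ(s,ψ)| = Re{∫_{1/2}^σ ℬ′/ℬ(σ′+it)dσ} < (1/2−σ)log P`.

with (§4 p. 8) `Z̃(s,ψ) = Z(s,ψ)Z(s,ψχ)`, "`χψ` is a primitive character `(mod Dp)`", and (§3 p. 7)
`F(s,ψ) = Σ_{n≤D⁴} ν(n)ψ(n)n^{−s}` with REAL coefficients `ν(n)` ((3.1)–(3.3)), `ψ̄ = ψ⁻¹`.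

The identity `|ℬ(1/2+it,ψ)| = 1` is the one input of Lemma 4.5's Case 2 that the companion module
`Zhang2022/Section4Lemma45` takes as a hypothesis (`Lemma45.log_norm_eq_re_integral`, `h1`). This file
PROVES it from the tree (namespace `Lemma45`; `GammaFactor.tildeZ`, `GammaFactor.norm_Zfac_half_eq_one`
of `Section4TildeZ` / `Section2AnalyticRootY`, and the Dirichlet polynomials `Lemma81.dirPoly` with
`Lemma81.conj_dirPoly` of `Section8Reflection`):

* `Lemma45.norm_tildeZ_half_eq_one` — `|Z̃(1/2+it)| = |Z(1/2+it,ψ)|·|Z(1/2+it,ψχ)| = 1` (`t > 0`, both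
  characters primitive);
* `Lemma45.one_sub_eq_conj_of_re_eq_half`, `Lemma45.dirPoly_inv_one_sub_eq_conj`,
  `Lemma45.norm_dirPoly_inv_one_sub_eq` — on `σ = 1/2`, `1 − s = s̄`, so for real coefficients
  `F(1−s,ψ̄) = conj F(s,ψ)` and `|F(1−s,ψ̄)| = |F(s,ψ)|`;
* `Lemma45.norm_calB_half_eq_one` — **`|ℬ(1/2+it,ψ)| = 1`** whenever `F(1/2+it,ψ) ≠ 0` (on `Ω₁` this
  is Lemma 4.2; where `F = 0`, `ℬ` is not defined).

Nothing about Theorems 1–2 of the source is stated or implied; nothing here bears on the cell's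
verdict on (8.24).

## References

* Y. Zhang, arXiv:2211.02515v1 (2022), §4 p. 9, proof of Lemma 4.5 (Case 2); §4 p. 8 (`Z̃`); §3 p. 7
  (`F`). [cite: Zhang2022LandauSiegel, §4 Lemma 4.5 (proof)]
-/

noncomputable section

open Complex ComplexConjugate

namespace Literature.NumberTheory.LFunctions.Zhang2022

namespace Lemma45

open GammaFactor Lemma81

/-- `|Z̃(1/2+it,ψ)| = |Z(1/2+it,ψ)|·|Z(1/2+it,ψχ)| = 1` for `t > 0` and primitive `ψ`, `ψχ`.
[cite: Zhang2022LandauSiegel, §4 Lemma 4.5 (proof)] -/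
theorem norm_tildeZ_half_eq_one {k₁ k₂ : ℕ} [NeZero k₁] [NeZero k₂] {ψ : DirichletCharacter ℂ k₁}
    {θ₂ : DirichletCharacter ℂ k₂} (hψ : ψ.IsPrimitive) (hθ : θ₂.IsPrimitive) {t : ℝ} (ht : 0 < t) :
    ‖tildeZ ψ θ₂ (1 / 2 + t * I)‖ = 1 := by
  rw [tildeZ_def, norm_mul, norm_Zfac_half_eq_one hψ ht, norm_Zfac_half_eq_one hθ ht, mul_one]

/-- On the critical line `1 − s = s̄`. [cite: Zhang2022LandauSiegel, §4 Lemma 4.5 (proof)] -/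
theorem one_sub_eq_conj_of_re_eq_half {s : ℂ} (hs : s.re = 1 / 2) : 1 - s = conj s := by
  apply Complex.ext
  · simp [hs]
    norm_num
  · simp

/-- **`F(1−s,ψ̄) = conj F(s,ψ)` on `σ = 1/2`** for a Dirichlet polynomial with real coefficients
(`ψ̄ = ψ⁻¹`). [cite: Zhang2022LandauSiegel, §4 Lemma 4.5 (proof)] -/
theorem dirPoly_inv_one_sub_eq_conj {k : ℕ} [NeZero k] (N : ℕ) {a : ℕ → ℂ}
    (ha : ∀ n, conj (a n) = a n) (ψ : DirichletCharacter ℂ k) {s : ℂ} (hs : s.re = 1 / 2) :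
    dirPoly N a ψ⁻¹ (1 - s) = conj (dirPoly N a ψ s) := by
  have hconj := conj_dirPoly N a ψ s
  have ha' : (fun n => conj (a n)) = a := funext ha
  rw [ha'] at hconj
  rw [one_sub_eq_conj_of_re_eq_half hs, hconj]

/-- `|F(1−s,ψ̄)| = |F(s,ψ)|` on `σ = 1/2` (real coefficients). [cite: Zhang2022LandauSiegel, §4 Lemma 4.5 (proof)] -/
theorem norm_dirPoly_inv_one_sub_eq {k : ℕ} [NeZero k] (N : ℕ) {a : ℕ → ℂ}
    (ha : ∀ n, conj (a n) = a n) (ψ : DirichletCharacter ℂ k) {s : ℂ} (hs : s.re = 1 / 2) :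
    ‖dirPoly N a ψ⁻¹ (1 - s)‖ = ‖dirPoly N a ψ s‖ := by
  rw [dirPoly_inv_one_sub_eq_conj N ha ψ hs, Complex.norm_conj]

/-- **"Since `|ℬ(1/2+it,ψ)| = 1`"**, EXACT: for `t > 0`, primitive `ψ` and `ψχ`, real coefficients
`ν`, and `F(1/2+it,ψ) ≠ 0`: `|Z̃(s)·F(1−s,ψ̄)/F(s,ψ)| = 1` at `s = 1/2 + it`.
[cite: Zhang2022LandauSiegel, §4 Lemma 4.5 (proof)] -/
theorem norm_calB_half_eq_one {k₁ k₂ : ℕ} [NeZero k₁] [NeZero k₂] {ψ : DirichletCharacter ℂ k₁}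
    {θ₂ : DirichletCharacter ℂ k₂} (hψ : ψ.IsPrimitive) (hθ : θ₂.IsPrimitive) (N : ℕ) {a : ℕ → ℂ}
    (ha : ∀ n, conj (a n) = a n) {t : ℝ} (ht : 0 < t) (hF : dirPoly N a ψ (1 / 2 + t * I) ≠ 0) :
    ‖tildeZ ψ θ₂ (1 / 2 + t * I) * dirPoly N a ψ⁻¹ (1 - (1 / 2 + t * I))
        / dirPoly N a ψ (1 / 2 + t * I)‖ = 1 := by
  have hs : ((1 : ℂ) / 2 + t * I).re = 1 / 2 := by simp
  rw [norm_div, norm_mul, norm_tildeZ_half_eq_one hψ hθ ht, one_mul,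
    norm_dirPoly_inv_one_sub_eq N ha ψ hs, div_self (norm_ne_zero_iff.mpr hF)]

end Lemma45

end Literature.NumberTheory.LFunctions.Zhang2022
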